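import Summits.HodgeConjecture.HodgeConjecture.Theorems.WeilTypeLadderAbsoluteHodge
import Summits.HodgeConjecture.HodgeConjecture.Theorems.HeckePrymWeilHodgeWeilOfStandardConjectureB
import Literature.AlgebraicGeometry.HodgeTheory.MotivatedClasses
import Literature.AlgebraicGeometry.HodgeTheory.LefschetzStandardConjectureFacts
import Literature.AlgebraicGeometry.HodgeTheory.AbsoluteHodgeClassesAbelianVarieties
import HarnessLib

/-!
# WeilTypeLadder · the MOTIVATED rung below the floor (André 1996, Thm. 0.6.2) and the Lefschetz-`B` joint

b2b cell `hweil` (packet `run/shared/lean/b2b/hodge-weil/`; LADDER.md `## CARVER` C1 row AH; brief (b):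
"André's motivated cycles / Deligne absolute Hodge on abelian varieties as fall-back giving weaker-but-landable
rungs"). Prover 2, generation 2 (variational). HONEST LABEL: every statement of §1 is a rung BELOW the floor —
a THEOREM in print (Y. André, *Pour une théorie inconditionnelle des motifs*, Publ. Math. IHÉS 83 (1996),
Thm. 0.6.2: "Tout cycle de Hodge `ξ` sur une variété abélienne `A` est motivé", refereed) rendered through the
tree's named fact `Andre1996_hodgeClasses_abelianVariety_motivated` (`Literature/…/MotivatedClasses.lean`), not
progress above Markman 2025. It sits BETWEEN the absolute-Hodge rung of the sibling file
`Theorems/WeilTypeLadderAbsoluteHodge.lean` (Deligne 1982) and algebraicity: motivated ⟹ absolute Hodge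
(André 1996, Prop. 2.5.1; tree fact `Andre1996_isAbsoluteHodgeClass_of_mem_motivatedClasses`, §2) and
motivated ⟹ algebraic GIVEN the Lefschetz standard conjecture `B` for the auxiliary varieties (André 1996,
§2.1 remark; tree fact `Andre1996_motivatedClasses_le_algebraicClasses_of_standardConjectureB`, §3).

§1 — for every rung predicate of the conjecture leaf `Theorems/WeilTypeLadder.lean` (R∞, R1′, R2₈, R2, R3) the
classes it speaks about are MOTIVATED classes of the abelian variety (conditional on the refereed André fact
only). §2 — hence absolute Hodge (André's route to Deligne's theorem; compare the Deligne-fact versions of the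
sibling). §3 — the joint with Grothendieck's `B`: `B` for all smooth projective complex varieties (in the
polarised form `StandardConjectureBStar`) together with André's two statements gives
`PadicSemiregularLift.HodgeAbelianVarieties` (stmt-HodgeConjecture-1333: the Hodge conjecture for EVERY complex
abelian variety) — recorded here as one decl — and therefore every rung of the ladder and the route target
`HeckePrymWeil.HodgeWeilLadder` (through the `…_of_hodgeAbelianVarieties` edges of the sibling). This is the
carver's DAG edge "B(all) ⟹ stmt-1333 ⟹ every rung", the algebraic shadow of André's theorem, exactly as
`ladder_of_hodgeConjectureQbar_of_deligne` is the arithmetic shadow of Deligne's.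

Serves stmt-HodgeConjecture-1259 without closing it. Sorry-free; no new definition; hypotheses are named facts
(D-0014) or route decls. Nothing here is a case of the Hodge conjecture proved unconditionally.
-/

-- every declaration of this problem lives in `Summit.HodgeConjecture.HodgeConjecture.…` (summit = sub-problem)
set_option linter.dupNamespace false

noncomputable section

open CategoryTheory

namespace Summit.HodgeConjecture.HodgeConjecture.WeilTypeLadder

open Literature.AlgebraicGeometry Literature.AlgebraicGeometry.Motives
open Literature.AlgebraicGeometry.HodgeTheory
open Literature.AlgebraicTopology.SingularHomology
open Summit.HodgeConjecture.HodgeConjecture.Theses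

/-! ### §1. The motivated rung (below the floor): every Weil class of the ladder is a motivated class -/

/-- **A rational `(p,p)`-class on an abelian variety of dimension `k` is motivated** (André 1996, Thm. 0.6.2),
in the rungs' shape `A.dim = k` (the smooth-projectivity witness is the tree's
`AbelianVariety.isSmoothProjective_holds`). CONDITIONAL only on the refereed named fact.
[cite: Andre1996Motifs, Thm. 0.6.2 (p. 9) and §6.3 (p. 31)] -/
theorem mem_motivatedClasses_of_andre (hAM : Andre1996_hodgeClasses_abelianVariety_motivated)
    {A : Motives.AbelianVariety ℂ} {k p : ℕ} (hA : A.dim = k) {c : complexBetti A.X (2 * p)}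
    (hcQ : IsRationalClass c) (hcH : IsOfHodgeType k A.X (2 * p) p p c) : c ∈ motivatedClasses k A.X p := by
  subst hA
  exact hAM A (Motives.AbelianVariety.isSmoothProjective_holds (A := A)) p c hcQ hcH

/-- **R∞ in motivated form** (André 1996, Thm. 0.6.2): in the binders of `WeilClassesImaginaryQuadratic`, every
rational `(n,n)`-class of the Weil plane `weilClassesOf A φ n d` of an abelian `2n`-fold with `φ ≫ φ = -d` is a
MOTIVATED class — every `n ≥ 2`, every `d`, every discriminant. CONDITIONAL only on the refereed named fact
(a theorem in print, not proved in the tree); BELOW the floor. [cite: Andre1996Motifs, Thm. 0.6.2 (p. 9)] -/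
theorem weilClassesImaginaryQuadratic_motivated (hAM : Andre1996_hodgeClasses_abelianVariety_motivated) :
    ∀ (n : ℕ), 2 ≤ n → ∀ (d : ℕ), 0 < d → ∀ (A : Motives.AbelianVariety ℂ) (φ : A ⟶ A), A.dim = 2 * n →
      Motives.IsSmoothProjective (2 * n) A.X → φ ≫ φ = -(d • 𝟙 A) →
        ∀ c : complexBetti A.X (2 * n), IsRationalClass c → IsOfHodgeType (2 * n) A.X (2 * n) n n c →
          c ∈ weilClassesOf A φ n d → c ∈ motivatedClasses (2 * n) A.X n :=
  fun _ _ _ _ _ _ hA _ _ _ hcQ hcH _ ↦ mem_motivatedClasses_of_andre hAM hA hcQ hcH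

/-- **R1′ in motivated form**: the Weil classes of a NON-split Weil-type abelian sixfold (the binders of
`NonsplitSixfolds`) are motivated (André 1996, Thm. 0.6.2) — the strongest thing known in print about them for
`(K, det H) ≠ (ℚ(√-3), 1)`. CONDITIONAL only on the refereed named fact; BELOW the floor.
[cite: Andre1996Motifs, Thm. 0.6.2 (p. 9)] [cite: Markman2025SurveySecant, §12] -/
theorem nonsplitSixfolds_motivated (hAM : Andre1996_hodgeClasses_abelianVariety_motivated) :
    ∀ (d : ℕ), 0 < d → ∀ (A : Motives.AbelianVariety ℂ) (φ : A ⟶ A), A.dim = 2 * 3 →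
      Motives.IsSmoothProjective (2 * 3) A.X → φ ≫ φ = -(d • 𝟙 A) →
        (∀ (e : Motives.ProjectiveEmbedding A.X) (a : complexBetti (Motives.projectiveSpace e.n ℂ) 2),
          IsRationalClass a → a ≠ 0 →
            ¬ Motives.IsHyperbolicWeilType A φ 3
              ((d : ℂ) • complexBetti.map e.ι 2 a +
                complexBetti.map φ.hom.hom.hom 2 (complexBetti.map e.ι 2 a))) →
          ∀ c : complexBetti A.X (2 * 3), IsRationalClass c → IsOfHodgeType (2 * 3) A.X (2 * 3) 3 3 c →
            c ∈ weilClassesOf A φ 3 d → c ∈ motivatedClasses (2 * 3) A.X 3 :=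
  fun _ _ _ _ hA _ _ _ _ hcQ hcH _ ↦ mem_motivatedClasses_of_andre hAM hA hcQ hcH

/-- **R2 / R2₈ in motivated form**: the Weil classes of a split Weil-type abelian `2n`-fold (the binders of
`SplitWeilAbelianVarieties`, any `n`, so also `SplitEightfolds` at `n = 4`) are motivated (André 1996,
Thm. 0.6.2). CONDITIONAL only on the refereed named fact; BELOW the floor. [cite: Andre1996Motifs, Thm. 0.6.2 (p. 9)] -/
theorem splitWeilAbelianVarieties_motivated (hAM : Andre1996_hodgeClasses_abelianVariety_motivated) :
    ∀ (n : ℕ) (d : ℕ) (A : Motives.AbelianVariety ℂ) (φ : A ⟶ A), A.dim = 2 * n →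
      ∀ (e : Motives.ProjectiveEmbedding A.X) (a : complexBetti (Motives.projectiveSpace e.n ℂ) 2),
        Motives.IsHyperbolicWeilType A φ n
          ((d : ℂ) • complexBetti.map e.ι 2 a +
            complexBetti.map φ.hom.hom.hom 2 (complexBetti.map e.ι 2 a)) →
          ∀ c : complexBetti A.X (2 * n), IsRationalClass c → IsOfHodgeType (2 * n) A.X (2 * n) n n c →
            c ∈ weilClassesOf A φ n d → c ∈ motivatedClasses (2 * n) A.X n :=
  fun _ _ _ _ hA _ _ _ _ hcQ hcH _ ↦ mem_motivatedClasses_of_andre hAM hA hcQ hcH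

/-- **R3 in motivated form** (André 1996, Thm. 0.6.2): in the binders of `WeilClassesCMField`, every rational
`(m,m)`-class of `weilClassesField A φ P (2m)` (`K = ℚ(φ)` a CM field of any degree) is a motivated class of
`A`. CONDITIONAL only on the refereed named fact; BELOW the floor. [cite: Andre1996Motifs, Thm. 0.6.2 (p. 9)] -/
theorem weilClassesCMField_motivated (hAM : Andre1996_hodgeClasses_abelianVariety_motivated) :
    ∀ (A : Motives.AbelianVariety ℂ) (φ : A ⟶ A) (P : Polynomial ℤ) (m : ℕ),
      ∀ c ∈ weilClassesField A φ P (2 * m), IsRationalClass c →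
        IsOfHodgeType A.dim A.X (2 * m) m m c → c ∈ motivatedClasses A.dim A.X m :=
  fun _ _ _ _ _ _ hcQ hcH ↦ mem_motivatedClasses_of_andre hAM rfl hcQ hcH

/-- **The route target `HeckePrymWeil.HodgeWeilLadder` in motivated form**: in the binders of the target
(stmt-HodgeConjecture-1259), every rational `(n,n)`-class of an abelian `2n`-fold with `φ ≫ φ = -p` is motivated
(the eigen-plane hypothesis is not needed: ALL Hodge classes of an abelian variety are motivated). CONDITIONAL
only on the refereed named fact. [cite: Andre1996Motifs, Thm. 0.6.2 (p. 9)] -/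
theorem hodgeWeilLadder_motivated (hAM : Andre1996_hodgeClasses_abelianVariety_motivated) :
    ∀ p : ℕ, p.Prime → p % 4 = 3 → 7 ≤ p → ∀ g : ℕ, 2 ≤ g → ∀ n : ℕ, n = (p - 1) / 2 * (g - 1) →
      ∀ (A : Motives.AbelianVariety ℂ) (φ : A ⟶ A), A.dim = 2 * n → φ ≫ φ = -((p : ℤ) • 𝟙 A) →
        ∀ c : complexBetti A.X (2 * n), IsRationalClass c → IsOfHodgeType (2 * n) A.X (2 * n) n n c →
          c ∈ motivatedClasses (2 * n) A.X n :=
  fun _ _ _ _ _ _ _ _ _ _ hA _ _ hcQ hcH ↦ mem_motivatedClasses_of_andre hAM hA hcQ hcH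

/-! ### §2. Motivated ⟹ absolute Hodge (André 1996, Prop. 2.5.1): the sibling's rung recovered André's way -/

/-- **R∞ in absolute-Hodge form, André's way** (Thm. 0.6.2 + Prop. 2.5.1, both refereed named facts): every
rational `(n,n)` Weil class of an abelian `2n`-fold with `φ ≫ φ = -d` is absolute Hodge. Same conclusion as
`weilClassesImaginaryQuadratic_absoluteHodge` (which uses Deligne 1982, Thm. 2.11 instead); recorded so that
the packet's trust-base table can cite either source. [cite: Andre1996Motifs, Thm. 0.6.2 (p. 9) and Prop. 2.5.1 (p. 18)] -/
theorem weilClassesImaginaryQuadratic_absoluteHodge_of_andre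
    (hAM : Andre1996_hodgeClasses_abelianVariety_motivated)
    (hAH : Andre1996_isAbsoluteHodgeClass_of_mem_motivatedClasses) :
    ∀ (n : ℕ), 2 ≤ n → ∀ (d : ℕ), 0 < d → ∀ (A : Motives.AbelianVariety ℂ) (φ : A ⟶ A), A.dim = 2 * n →
      Motives.IsSmoothProjective (2 * n) A.X → φ ≫ φ = -(d • 𝟙 A) →
        ∀ c : complexBetti A.X (2 * n), IsRationalClass c → IsOfHodgeType (2 * n) A.X (2 * n) n n c →
          c ∈ weilClassesOf A φ n d → IsAbsoluteHodgeClass (2 * n) A.X n c :=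
  fun n hn d hd A φ hA hX hφ c hcQ hcH hc ↦
    hAH hX n c hcQ (weilClassesImaginaryQuadratic_motivated hAM n hn d hd A φ hA hX hφ c hcQ hcH hc)

/-! ### §3. The joint with Grothendieck's `B`: `B(all) ∧ André ⟹ HC for abelian varieties ⟹ every rung` -/

/-- **`B` for all smooth projective complex varieties, with André's two statements, gives the Hodge
conjecture for EVERY complex abelian variety** (`PadicSemiregularLift.HodgeAbelianVarieties`,
stmt-HodgeConjecture-1333) — CONDITIONAL: `hB` is Grothendieck's standard conjecture of Lefschetz type in the
polarised form `StandardConjectureBStar` for every smooth projective `Z` (OPEN), `hBA` is André's §2.1 remark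
(motivated classes are algebraic under `B`) and `hAM` his Thm. 0.6.2, both refereed named facts. The
Hodge-model conjunct of `HodgeConjectureFor` is the tree's theorem `nonempty_hodgeModel_holds`; the cycle
conjunct is `Theorems.HeckePrymWeilLine.hodgeClasses_abelianVariety_algebraic_of_standardConjectureB`.
[cite: Andre1996Motifs, Thm. 0.6.2 (p. 9) and §2.1 remark following Déf. 1 (p. 14)]
[cite: Grothendieck1968, §3 p. 196 (B(X))] -/
theorem hodgeAbelianVarieties_of_standardConjectureB_of_andre
    (hB : ∀ (d : ℕ) (Z : SchemeOver ℂ) (η : complexBetti Z 2), IsSmoothProjective d Z →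
      StandardConjectureBStar d Z η)
    (hBA : Andre1996_motivatedClasses_le_algebraicClasses_of_standardConjectureB)
    (hAM : Andre1996_hodgeClasses_abelianVariety_motivated) :
    PadicSemiregularLift.HodgeAbelianVarieties :=
  fun A ↦ ⟨nonempty_hodgeModel_holds (Motives.AbelianVariety.isSmoothProjective_holds (A := A)),
    fun q c hcQ hcH ↦
      Theorems.HeckePrymWeilLine.hodgeClasses_abelianVariety_algebraic_of_standardConjectureB
        hB hBA hAM A q c hcQ hcH⟩

/-- **Every rung of the Weil-type ladder, and the route target, from `B(all)` and André's theorem**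
(CONDITIONAL on the open conjecture `B` for all smooth projective complex varieties and the two refereed
André facts): `B ∧ [André §2.1] ∧ [André 0.6.2]` ⟹ R∞ ∧ R1′ ∧ R2₈ ∧ R2 ∧ R3 ∧ `HeckePrymWeil.HodgeWeilLadder`.
The whole ladder is dominated by the Lefschetz standard conjecture — the algebraic shadow of André's theorem,
as `ladder_of_hodgeConjectureQbar_of_deligne` is the arithmetic shadow of Deligne's. (André's finer statement
needs `B` only for products `A × B × Y₁ × ⋯ × Y_k`, `B` abelian, `Yᵢ` total spaces of compact pencils of
abelian varieties; the tree's fact allows every auxiliary variety, so `B(all)` is what is recorded.)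
[cite: Andre1996Motifs, Thm. 0.6.2 (p. 9) and §2.1 remark (p. 14)] [cite: Grothendieck1968, §3 p. 196 (B(X))] -/
theorem ladder_of_standardConjectureB_of_andre
    (hB : ∀ (d : ℕ) (Z : SchemeOver ℂ) (η : complexBetti Z 2), IsSmoothProjective d Z →
      StandardConjectureBStar d Z η)
    (hBA : Andre1996_motivatedClasses_le_algebraicClasses_of_standardConjectureB)
    (hAM : Andre1996_hodgeClasses_abelianVariety_motivated) :
    WeilClassesImaginaryQuadratic ∧ NonsplitSixfolds ∧ SplitEightfolds ∧ SplitWeilAbelianVarieties ∧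
      WeilClassesCMField ∧ HeckePrymWeil.HodgeWeilLadder :=
  have hAV := hodgeAbelianVarieties_of_standardConjectureB_of_andre hB hBA hAM
  ⟨weilClassesImaginaryQuadratic_of_hodgeAbelianVarieties hAV, nonsplitSixfolds_of_hodgeAbelianVarieties hAV,
    splitEightfolds_of_hodgeAbelianVarieties hAV, splitWeilAbelianVarieties_of_hodgeAbelianVarieties hAV,
    weilClassesCMField_of_hodgeAbelianVarieties hAV, hodgeWeilLadder_of_hodgeAbelianVarieties hAV⟩

end Summit.HodgeConjecture.HodgeConjecture.WeilTypeLadder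

end
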